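import Summits.RiemannHypothesis.RiemannHypothesis.Theorems.WeilFormatCWindowGram
import Literature.NumberTheory.LFunctions.WeilWindowSuzukiContinuityProofs
import HarnessLib

/-!
# Format C (Fourier–Galerkin certificates of Weil positivity): the MARGIN dictionary —
  a Gram certificate with margin `μ` gives `μ ≤ ε(a) = weilGroundEnergy a`

Helper file (`--supports stmt-RiemannHypothesis-0098`, lead-track anchor), RH-free. Seat
rh-explicit-weil-3 (gen3). Sequel of `WeilFormatCWindowDictionary.lean` (non-strict dictionary) and
`WeilFormatCWindowGram.lean` (Gram expansion, real reduction); uses weil-2's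
`integral_norm_sq_sum_smul_chi` (`‖Σ c_n χ_n‖₂² = Σ |c_n|²`, `WeilFormatCEntryBasis.lean`) and the
tree's `le_weilGroundEnergy_of_forall` (`WeilWindowSuzukiContinuityProofs.lean`).

A certificate usually proves MORE than `G ⪰ 0`: it proves `G − μ·1 ⪰ 0` for an explicit rational `μ > 0`
(the strict rungs of the ladder, e.g. `weilGroundEnergy_M72_ge : 10⁻¹⁵ ≤ ε(18/25)`; Yoshida's threshold
theory needs `0 < ε(a)`). This file turns such a certificate into the margin statement:

* `window_margin_of_trig_margin`: if `μ‖u‖₂² ≤ weilWindowForm a u` on every trigonometric window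
  `u = Σ_{|n|≤N} c_n χ_n`, then `μ‖g‖₂² ≤ Re Q(g)` for every test function `g` supported in `[-a, a]`
  (pass to the limit along the truncated Fourier series on both sides);
* `le_weilGroundEnergy_of_trig_margin`: hence `μ ≤ weilGroundEnergy a`;
* `le_weilGroundEnergy_of_gram_margin`: Gram form — if `μ Σ|c_n|² ≤ Re Σ c_m conj(c_n) G(m,n)` for all
  `N`, `c` (`G(m,n) = weilWindowSesq a χ_m χ_n`; i.e. `G − μ·1 ⪰ 0` in the orthonormal basis `χ`), then
  `μ ≤ weilGroundEnergy a`.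
-/

set_option autoImplicit false
set_option linter.dupNamespace false  -- the mandated namespace repeats `RiemannHypothesis`

noncomputable section

open Complex Filter Set MeasureTheory
open scoped Real Topology ComplexConjugate

namespace Summit.RiemannHypothesis.RiemannHypothesis.Theorems.WeilFormatC

open Literature.NumberTheory.LFunctions
open Literature.NumberTheory.LFunctions.Yoshida1992 (modes chi proj trigPoly
  proj_apply_of_mem proj_apply_of_not_mem proj_apply_eq_indicator_trigPoly norm_trigPoly_le
  norm_sub_trigPoly_le tendsto_tsum_compl_modes summable_pow_mul_norm_fourierCoeff C_le_K)

variable {a : ℝ}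

/-- Along the truncated Fourier series of `φ ∈ K(a)` the `L²` norms converge:
`∫ ‖proj a N φ‖² → ∫ ‖φ‖²` (`a > 0`). -/
theorem tendsto_integral_norm_sq_proj (ha : 0 < a) {φ : ℝ → ℂ} (hφ : φ ∈ Yoshida1992.K a) :
    Tendsto (fun N ↦ ∫ x : ℝ, ‖proj a N φ x‖ ^ 2) atTop (𝓝 (∫ x : ℝ, ‖φ x‖ ^ 2)) := by
  have hsum0 : Summable fun n : ℤ ↦ ‖Yoshida1992.fourierCoeff a n φ‖ := by
    simpa using summable_pow_mul_norm_fourierCoeff ha hφ 0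
  have hcont : ∀ N, Continuous (trigPoly a N φ) := fun N ↦
    continuous_finsetSum _ fun n _ ↦ continuous_const.mul
      (Complex.continuous_exp.comp ((continuous_const.mul Complex.continuous_ofReal).div_const _))
  refine tendsto_integral_norm_sq_of_uniform (u := fun N ↦ proj a N φ)
    (S₀ := ∑' n : ℤ, ‖Yoshida1992.fourierCoeff a n φ‖ / (2 * a))
    (δ := fun N ↦ ∑' n : {n // n ∉ modes N}, ‖Yoshida1992.fourierCoeff a n φ‖ / (2 * a))
    (fun N ↦ ?_) (fun N x hx ↦ proj_apply_of_not_mem ha N φ hx) (fun N x ↦ ?_) (fun N x ↦ ?_)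
    (tendsto_tsum_compl_modes a φ)
  · have : proj a N φ = (Icc (-a) a).indicator (trigPoly a N φ) :=
      funext fun x ↦ proj_apply_eq_indicator_trigPoly ha N φ x
    rw [this]
    exact (hcont N).measurable.indicator measurableSet_Icc
  · by_cases hx : x ∈ Icc (-a) a
    · rw [proj_apply_of_mem ha N φ hx]
      exact norm_trigPoly_le ha hsum0 N x
    · rw [proj_apply_of_not_mem ha N φ hx, norm_zero]
      exact tsum_nonneg fun n ↦ by positivity
  · by_cases hx : x ∈ Icc (-a) a
    · rw [proj_apply_of_mem ha N φ hx, norm_sub_rev]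
      exact norm_sub_trigPoly_le ha hφ N hx
    · rw [proj_apply_of_not_mem ha N φ hx,
        Yoshida1992.eq_zero_of_mem_K hφ (lt_abs_of_not_mem_Icc_window hx), sub_zero, norm_zero]
      exact tsum_nonneg fun n ↦ by positivity

/-- **The margin dictionary (window form).** Let `a > 0`. If `μ ∫‖u‖² ≤ weilWindowForm a u` for every
trigonometric window `u = Σ_{|n| ≤ N} c_n χ_n`, then `μ ∫‖g‖² ≤ Re Q(g)` for every test function `g`
supported in `[-a, a]`. -/
theorem window_margin_of_trig_margin (ha : 0 < a) {μ : ℝ}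
    (h : ∀ (N : ℕ) (c : ℤ → ℂ), μ * ∫ x : ℝ, ‖(∑ n ∈ modes N, c n • chi a n) x‖ ^ 2 ≤
      weilWindowForm a (∑ n ∈ modes N, c n • chi a n))
    {g : ℝ → ℂ} (hg : IsWeilTest g) (hsupp : tsupport g ⊆ Icc (-a) a) :
    μ * ∫ x : ℝ, ‖g x‖ ^ 2 ≤ (weilQuadratic g).re := by
  have hK : g ∈ Yoshida1992.K a := C_le_K ha ⟨hg, hsupp⟩
  rw [← weilWindowForm_eq_re_weilQuadratic hg hsupp]
  refine le_of_tendsto_of_tendsto' ((tendsto_integral_norm_sq_proj ha hK).const_mul μ)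
    (tendsto_weilWindowForm_proj ha hK) fun N ↦ ?_
  exact h N fun n ↦ (((1 / Real.sqrt (2 * a) : ℝ) : ℂ) * Yoshida1992.fourierCoeff a n g)

/-- **The margin dictionary (ground energy).** Under the same hypothesis, `μ ≤ ε(a)`. -/
theorem le_weilGroundEnergy_of_trig_margin (ha : 0 < a) {μ : ℝ}
    (h : ∀ (N : ℕ) (c : ℤ → ℂ), μ * ∫ x : ℝ, ‖(∑ n ∈ modes N, c n • chi a n) x‖ ^ 2 ≤
      weilWindowForm a (∑ n ∈ modes N, c n • chi a n)) :
    μ ≤ weilGroundEnergy a := by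
  refine le_weilGroundEnergy_of_forall ha fun g hg hsupp hnorm ↦ ?_
  have := window_margin_of_trig_margin ha h hg hsupp
  rwa [hnorm, mul_one] at this

/-- **The margin dictionary (Gram form).** Let `a > 0` and `G(m,n) = weilWindowSesq a χ_m χ_n`. If
`μ Σ_{|n|≤N} |c_n|² ≤ Re Σ_{m,n} c_m conj(c_n) G(m,n)` for all `N` and all `c` — i.e. `G − μ·1 ⪰ 0` as
hermitian forms on the orthonormal trigonometric windows — then `μ ≤ weilGroundEnergy a`. -/
theorem le_weilGroundEnergy_of_gram_margin (ha : 0 < a) {μ : ℝ}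
    (h : ∀ (N : ℕ) (c : ℤ → ℂ), μ * ∑ n ∈ modes N, ‖c n‖ ^ 2 ≤
      (∑ m ∈ modes N, ∑ n ∈ modes N, c m * conj (c n) * weilWindowSesq a (chi a m) (chi a n)).re) :
    μ ≤ weilGroundEnergy a := by
  refine le_weilGroundEnergy_of_trig_margin ha fun N c ↦ ?_
  rw [integral_norm_sq_sum_smul_chi ha (modes N) c,
    weilWindowForm_sum_smul_eq_re ha.le (modes N) (fun n _ ↦ isWindowFunction_chi ha n) c a]
  exact h N c

/-- **The margin dictionary (REAL Gram form).** If the Gram entries are real and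
`μ Σ x_n² ≤ Σ x_m x_n Re G(m,n)` for every `N` and every REAL vector `x` — `Re G − μ·1 ⪰ 0` as a real
symmetric matrix, the output of an `LDLᵀ` check on `G − μ·1` — then `μ ≤ weilGroundEnergy a`. -/
theorem le_weilGroundEnergy_of_real_gram_margin (ha : 0 < a) {μ : ℝ}
    (hreal : ∀ m n : ℤ, (weilWindowSesq a (chi a m) (chi a n)).im = 0)
    (h : ∀ (N : ℕ) (x : ℤ → ℝ), μ * ∑ n ∈ modes N, x n ^ 2 ≤
      ∑ m ∈ modes N, ∑ n ∈ modes N, x m * x n * (weilWindowSesq a (chi a m) (chi a n)).re) :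
    μ ≤ weilGroundEnergy a := by
  refine le_weilGroundEnergy_of_gram_margin ha fun N c ↦ ?_
  rw [re_sum_sum_mul_conj_mul_eq (modes N) (fun m _ n _ ↦ hreal m n) c]
  have hsplit : ∑ n ∈ modes N, ‖c n‖ ^ 2 =
      (∑ n ∈ modes N, (c n).re ^ 2) + ∑ n ∈ modes N, (c n).im ^ 2 := by
    rw [← Finset.sum_add_distrib]
    exact Finset.sum_congr rfl fun n _ ↦ by rw [Complex.sq_norm, Complex.normSq_apply]; ring
  rw [hsplit, mul_add]
  exact add_le_add (h N fun n ↦ (c n).re) (h N fun n ↦ (c n).im)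

end Summit.RiemannHypothesis.RiemannHypothesis.Theorems.WeilFormatC

end
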